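import Summits.MatrixMultiplication.MatrixMultiplication.Theorems.SaturationLadderCurvilinearDomination
import Summits.MatrixMultiplication.MatrixMultiplication.Theorems.SaturationLadderSplitCwGram
import Literature.Barriers.MatrixMultiplication.UniversalMethodBarrierDegeneration
import HarnessLib

/-!
# Route `SaturationLadder` — curvilinear domination: the truncated polynomial algebra degenerates to the
# big Coppersmith–Winograd tensor, `Str(ℂ[t]/(t^{q+2})) ⊵ CW_q`, for EVERY `q`
# (decomp-mm lens 1 «grading / quantitative ladder», gen 41; support kernel beneath crux `SubexpSaturation`,
# stmt-MatrixMultiplication-25909; part 3 of 3 — assembles part 1 `SaturationLadderCurvilinearDomination`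
# (`P_{q+2} ⊵ L_q`) and part 2 `SaturationLadderSplitCwGram` (the Gram identity); answers the census question
# CURVILINEAR (E3′) of memo `decomp-mm-lens-1/gen40/NODE-SaturationLadder-g40.md` §3b)

PROVED, 0 sorry; no definitions, no instances, no named facts.  Tensors are bare functions
`Fin n → Fin n → Fin n → K` as everywhere in `Literature.Computability.AlgebraicComplexity`;
`truncPolyMulTensor K m z x y = [x + y = z]` (BCS Ex. (15.20)), `bigCwTensor K q` = CVZ's `CW_q` (Thm. 22:
`e_{0,0,q+1} + e_{0,q+1,0} + e_{q+1,0,0} + Σ_{i=1}^q (e_{0,i,i} + e_{i,0,i} + e_{i,i,0})`), `PolyDegeneratesTo` =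
BCS (15.19) polynomial degeneration, `TensorRestrictsTo` = BCS (14.4) restriction by three matrices.

SETTING (memo `decomp-mm-lens-1/gen41/NODE-SaturationLadder-g41.md` §1).  Item 25909 asks for exactly tight thin
shapes `ω(1,t,r) = 1 + r`, `r ≤ exp(c/(1−t))`, for EVERY `c > 0`; the lineage proved the rate down to
`c₂ = 1.0650531` and located the floor `c⋆ = 1.0645958` of the single-scale additive laser class on the
Coppersmith–Winograd family, and its unique-usage map (gens 37–40) showed that every graded-algebra base able to
host a far-edge certificate is a connected sum `CW_ρ # N_k` — a degeneration of `CW_{ρ+k}`.  The repair census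
(gen 40 §3b, question CURVILINEAR) asked whether this whole map sits below ONE tensor per format: is `CW_q` a
degeneration of the structure tensor `P_{q+2} = Str(K[t]/(t^{q+2}))` of the curvilinear (truncated polynomial)
algebra — the textbook minimal-border-rank algebra (BCS Ex. (15.20), in tree `algBorderRank_truncPolyMulTensor`)?
This file proves: YES, for every `q`, over every field containing a square root of `−1` in which `2 ≠ 0`, in
particular over `ℂ`.  (`CW_q` itself is the structure tensor of the smoothable algebra
`k[x_1,…,x_q]/(x_i x_j, x_i² − x_j², x_i³)`, Bläser–Lysikov §3.4; among `1`-generic tensors it has next-to-maximal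
symmetry, Conner–Gesmundo–Landsberg–Ventura arXiv:1909.09518 Thm. 1(2) — consistent with lying low in the
degeneration order.  Search record for the statement `P_{q+2} ⊵ CW_q` itself: memo §3.)

THE THEOREMS (parts 1–2 recalled for orientation; this file proves the last two groups).
* part 1, `isCombDegeneration_truncPoly_splitCw` — on the support `Φ = {(z;x,y) : x + y = z}` of `P_{q+2}` the weights
  `a(z) = w(z)`, `b(x) = −w(x)`, `c(y) = −w(y)`, `w(i) = min (i−1) (q−1)` (`w(0) = 0`), vanish in sum exactly on
  `Ψ_q = Φ ∩ {x = 0 ∨ y = 0 ∨ z = q+1}` and are `= 1` on `Φ ∖ Ψ_q`: a combinatorial degeneration, BCS Def. (15.29);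
* part 1, `truncPolyMulTensor_polyDegeneratesTo_splitCw` — hence (BCS Prop. (15.30), in tree `BCS1997_prop_15_30`, finest
  blocking) `P_{q+2} ⊵ L_q` over every commutative semiring, where `L_q = [x + y = z ∧ (x = 0 ∨ y = 0 ∨ z = q+1)]`
  is the SPLIT big Coppersmith–Winograd tensor: the structure tensor of `K·1 ⊕ (K x_1 ⊕ ⋯ ⊕ K x_q) ⊕ K·s` with
  `x_i x_j = [i + j = q+1] s` (monomially: `t^z ↦ ε^{w(z)} t^z`);  `…_kroneckerPow_…` for powers;
* part 2 `pairing_gram`; here `bigCwTensor_apply_eq_indicator`, `tensorRestrictsTo_splitCw_bigCwTensor_of_matrices`,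
  `tensorRestrictsTo_splitCw_bigCwTensor` — the explicit change of basis `U` (on each pair `{p, q+1−p}`, `p < q+1−p`, the block `(1, i ; −i/2, 1/2)`; `1` at a
  fixed point) carries the split form `Σ_a x_a x_{q+1−a}` to CVZ's diagonal form `Σ_j y_j²`, and with the unit/socle
  index swap on the output leg gives `(A ⊗ B ⊗ B) L_q = CW_q`: `L_q ≥ CW_q` whenever `i² = −1`, `2 ≠ 0`
  (over `ℚ`, `ℝ` the two are not isomorphic for odd `q` — split versus definite form; the summit is over `ℂ`);
* `truncPolyMulTensor_polyDegeneratesTo_bigCwTensor`, `…_complex`, `…_kroneckerPow_…`,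
  `asymptoticRank_bigCwTensor_le_truncPolyMulTensor(_complex)` —
  **`P_{q+2} ⊵ CW_q`**, its Kronecker powers, and `R̃(CW_q) ≤ R̃(P_{q+2})`.

CONSEQUENCES FOR ITEM 25909 (memo §2; by hand from these theorems, same standing as Theorem F of gen 37).
(a) DOWN-SET.  `CW_ρ # N_k ⊴ CW_{ρ+k} ⊴ P_{ρ+k+2}`: every base of the unique-usage map, hence every certificate of
the single-scale additive laser class in which `c⋆` and `c₂` live, is a polynomial-degeneration certificate on
Kronecker powers of ONE curvilinear tensor `P_m` per format (`PolyDegeneratesTo.trans`, `.kroneckerPow`): the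
class «degeneration method applied to `P_m`» contains the lineage's class, with the same border-rank budget `m`.
(b) BARRIER PLACEMENT of that enlargement.  CVZ tabulate irreversibility barriers for `CW_q` AND for
`t_n = P_n` side by side: "the `CW_q`-barrier increases with `q` (converging to 3), whereas the `t_n`-barrier
decreases with `n` (converging to 2)"; Strassen (1991) computed the whole asymptotic spectrum `[z(n), n]` of
`K[x]/(x^n)` (CVZ, Universal points, §4.2.1).  So the passage `CW_q ↦ P_{q+2}` licensed by this file enlarges
the base family in the one direction on which the catalogued irreversibility ceiling RECEDES to `2`; whether
`P_m`-laser designs beat the thin-shape class floor `c⋆` is open (census offer «P-LASER», memo §5) — a statement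
about the base tensors hosting a certificate, not about `ω`.
(c) The `(M;M,M)` block `{x + y = z, 1 ≤ x, y, z ≤ q}` of `P_{q+2}` killed by the degeneration is exactly the
extra support a `P_m`-design may use and a `CW_q`-design cannot.
[cite: BurgisserClausenShokrollahi1997, Def. (15.29), Prop. (15.30), Ex. (15.20), (14.4); ChristandlVranaZuiddam2021,
Thm. 22 and §1.4 (barrier tables for `CW_q` and `t_n`); BlaserLysikov2016, §3.4; ChristandlVranaZuiddam2023, §4.2.1;
Strassen1991; CoppersmithWinograd1990, §6–§8]
-/

set_option linter.dupNamespace false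

noncomputable section

open scoped BigOperators Polynomial

namespace Summit.MatrixMultiplication.MatrixMultiplication.Theorems.SaturationLadderCurvilinearDominationCw

open Literature.Computability.AlgebraicComplexity Literature.Barriers.MatrixMultiplication
open Summit.MatrixMultiplication.MatrixMultiplication.Theorems.SaturationLadderCurvilinearDomination
open Summit.MatrixMultiplication.MatrixMultiplication.Theorems.SaturationLadderSplitCwGram

universe u

variable {K : Type u} [Field K] {q : ℕ}

/-- Every index of `Fin (q+2)` is `0`, `q+1`, or in the middle range `[1,q]`. [cite: ChristandlVranaZuiddam2021, Thm. 22] -/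
theorem fin_trichotomy_zero_last (x : Fin (q + 2)) : x = 0 ∨ x = Fin.last (q + 1) ∨ (x ≠ 0 ∧ x ≠ Fin.last (q + 1)) := by
  by_cases h0 : x = 0
  · exact Or.inl h0
  by_cases hl : x = Fin.last (q + 1)
  · exact Or.inr (Or.inl hl)
  exact Or.inr (Or.inr ⟨h0, hl⟩)

/-- The entries of `CW_q` (`bigCwTensor_apply`) as a polynomial in indicator functions of its three legs —
the shape produced by contracting `L_q` with the matrices of `tensorRestrictsTo_splitCw_bigCwTensor_of_matrices`.
[cite: ChristandlVranaZuiddam2021, Thm. 22] -/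
theorem bigCwTensor_apply_eq_indicator (q : ℕ) (a b c : Fin (q + 2)) :
    bigCwTensor K q a b c =
      (if b = 0 then (1 : K) else 0) *
          ((if a = Fin.last (q + 1) then (1 : K) else 0) * (if c = 0 then (1 : K) else 0) +
            (if a = 0 then (1 : K) else 0) * (if c = Fin.last (q + 1) then (1 : K) else 0) +
            (if a = c ∧ a ≠ 0 ∧ a ≠ Fin.last (q + 1) then (1 : K) else 0)) +
        (if c = 0 then (1 : K) else 0) *
          ((if a = 0 then (1 : K) else 0) * (if b = Fin.last (q + 1) then (1 : K) else 0) +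
            (if a = b ∧ a ≠ 0 ∧ a ≠ Fin.last (q + 1) then (1 : K) else 0)) +
        (if a = 0 then (1 : K) else 0) *
          (if b = c ∧ b ≠ 0 ∧ b ≠ Fin.last (q + 1) then (1 : K) else 0) := by
  have hl0 : (Fin.last (q + 1) : Fin (q + 2)) ≠ 0 := by simp [Fin.ext_iff]
  rw [bigCwTensor_apply]
  rcases fin_trichotomy_zero_last a with rfl | rfl | ⟨ha0, hal⟩ <;> rcases fin_trichotomy_zero_last b with rfl | rfl | ⟨hb0, hbl⟩ <;>
    rcases fin_trichotomy_zero_last c with rfl | rfl | ⟨hc0, hcl⟩ <;> simp [hl0.symm, *]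

/-- **`L_q ≥ CW_q` from abstract matrices.**  If `U` satisfies the Gram identity of `pairing_gram` and
`A`, `B` act as follows — `A` swaps the unit index `0` with the socle index `q+1` and is `U (q+1−a) ·` on the
middle range; `B` fixes `0` and `q+1` and is `U b ·` on the middle range — then
`(A ⊗ B ⊗ B) · L_q = CW_q` (`TensorRestrictsTo L_q CW_q`, BCS (14.4)).  Index bookkeeping: the unit of the
algebra sits at index `0` on all three legs of `L_q` but CVZ's `CW_q` puts the output-unit at `q+1`
(`e_{q+1,0,0}`) and the socle output at `0` (`e_{0,i,i}`, `e_{0,0,q+1}`), whence the swap in `A`.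
[cite: BurgisserClausenShokrollahi1997, (14.4); ChristandlVranaZuiddam2021, Thm. 22] -/
theorem tensorRestrictsTo_splitCw_bigCwTensor_of_matrices (q : ℕ) (U A B : Fin (q + 2) → Fin (q + 2) → K)
    (hG : ∀ j k : Fin (q + 2),
      ∑ a, (if a = 0 ∨ a = Fin.last (q + 1) then (0 : K) else U (Fin.rev a) j * U a k) =
        if j = k ∧ j ≠ 0 ∧ j ≠ Fin.last (q + 1) then 1 else 0)
    (hA0 : ∀ a', A a' 0 = if a' = Fin.last (q + 1) then 1 else 0)
    (hAl : ∀ a', A a' (Fin.last (q + 1)) = if a' = 0 then 1 else 0)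
    (hAM : ∀ a' a, a ≠ 0 → a ≠ Fin.last (q + 1) → A a' a = U (Fin.rev a) a')
    (hB0 : ∀ b', B b' 0 = if b' = 0 then 1 else 0)
    (hBl : ∀ b', B b' (Fin.last (q + 1)) = if b' = Fin.last (q + 1) then 1 else 0)
    (hBM : ∀ b' b, b ≠ 0 → b ≠ Fin.last (q + 1) → B b' b = U b b') :
    TensorRestrictsTo
      (fun z x y : Fin (q + 2) =>
        if (x : ℕ) + (y : ℕ) = (z : ℕ) ∧ ((x : ℕ) = 0 ∨ (y : ℕ) = 0 ∨ (z : ℕ) = q + 1) then (1 : K) else 0)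
      (bigCwTensor K q) := by
  refine ⟨A, B, B, fun a' b' c' => ?_⟩
  have hl0 : (Fin.last (q + 1) : Fin (q + 2)) ≠ 0 := by simp [Fin.ext_iff]
  simp only [splitCw_apply_eq_sum (K := K) q, mul_add, Finset.sum_add_distrib]
  rw [sum_unitLeft, sum_unitRight, sum_pairing]
  have h1 : ∑ a, A a' a * B b' 0 * B c' a = B b' 0 * (A a' 0 * B c' 0 +
      A a' (Fin.last (q + 1)) * B c' (Fin.last (q + 1)) +
      (if a' = c' ∧ a' ≠ 0 ∧ a' ≠ Fin.last (q + 1) then 1 else 0)) := by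
    have hpt : ∀ a, A a' a * B b' 0 * B c' a = B b' 0 * ((if a = 0 then A a' 0 * B c' 0 else 0) +
        (if a = Fin.last (q + 1) then A a' (Fin.last (q + 1)) * B c' (Fin.last (q + 1)) else 0) +
        (if a = 0 ∨ a = Fin.last (q + 1) then 0 else U (Fin.rev a) a' * U a c')) := by
      intro a
      by_cases ha0 : a = 0
      · rw [ha0, if_pos (rfl : (0 : Fin (q + 2)) = 0),
          if_neg (show (0 : Fin (q + 2)) ≠ Fin.last (q + 1) from hl0.symm),
          if_pos (show (0 : Fin (q + 2)) = 0 ∨ (0 : Fin (q + 2)) = Fin.last (q + 1) from Or.inl rfl)]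
        ring
      · by_cases hal : a = Fin.last (q + 1)
        · rw [hal, if_neg (show (Fin.last (q + 1) : Fin (q + 2)) ≠ 0 from hl0),
            if_pos (rfl : (Fin.last (q + 1) : Fin (q + 2)) = Fin.last (q + 1)),
            if_pos (show (Fin.last (q + 1) : Fin (q + 2)) = 0 ∨ Fin.last (q + 1) = Fin.last (q + 1)
              from Or.inr rfl)]
          ring
        · rw [if_neg ha0, if_neg hal, if_neg (not_or.mpr ⟨ha0, hal⟩), hAM a' a ha0 hal,
            hBM c' a ha0 hal]
          ring
    simp_rw [hpt]
    rw [← Finset.mul_sum, Finset.sum_add_distrib, Finset.sum_add_distrib, hG]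
    simp only [Finset.sum_ite_eq', Finset.mem_univ, if_true]
  have h2 : ∑ a, (if a = 0 then (0 : K) else A a' a * B b' a * B c' 0) = B c' 0 *
      (A a' (Fin.last (q + 1)) * B b' (Fin.last (q + 1)) +
      (if a' = b' ∧ a' ≠ 0 ∧ a' ≠ Fin.last (q + 1) then 1 else 0)) := by
    have hpt : ∀ a, (if a = 0 then (0 : K) else A a' a * B b' a * B c' 0) = B c' 0 *
        ((if a = Fin.last (q + 1) then A a' (Fin.last (q + 1)) * B b' (Fin.last (q + 1)) else 0) +
        (if a = 0 ∨ a = Fin.last (q + 1) then 0 else U (Fin.rev a) a' * U a b')) := by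
      intro a
      by_cases ha0 : a = 0
      · rw [ha0, if_pos (rfl : (0 : Fin (q + 2)) = 0),
          if_neg (show (0 : Fin (q + 2)) ≠ Fin.last (q + 1) from hl0.symm),
          if_pos (show (0 : Fin (q + 2)) = 0 ∨ (0 : Fin (q + 2)) = Fin.last (q + 1) from Or.inl rfl)]
        ring
      · by_cases hal : a = Fin.last (q + 1)
        · rw [hal, if_neg (show (Fin.last (q + 1) : Fin (q + 2)) ≠ 0 from hl0),
            if_pos (rfl : (Fin.last (q + 1) : Fin (q + 2)) = Fin.last (q + 1)),
            if_pos (show (Fin.last (q + 1) : Fin (q + 2)) = 0 ∨ Fin.last (q + 1) = Fin.last (q + 1)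
              from Or.inr rfl)]
          ring
        · rw [if_neg ha0, if_neg hal, if_neg (not_or.mpr ⟨ha0, hal⟩), hAM a' a ha0 hal,
            hBM b' a ha0 hal]
          ring
    simp_rw [hpt]
    rw [← Finset.mul_sum, Finset.sum_add_distrib, hG]
    simp only [Finset.sum_ite_eq', Finset.mem_univ, if_true]
  have h3 : ∑ b, (if b = 0 ∨ b = Fin.last (q + 1) then (0 : K)
      else A a' (Fin.last (q + 1)) * B b' b * B c' (Fin.rev b)) =
      A a' (Fin.last (q + 1)) * (if b' = c' ∧ b' ≠ 0 ∧ b' ≠ Fin.last (q + 1) then 1 else 0) := by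
    rw [← hG b' c', Finset.mul_sum]
    refine Fintype.sum_equiv Fin.revPerm _ _ fun b => ?_
    simp only [Fin.revPerm_apply, Fin.rev_rev]
    by_cases hb : b = 0 ∨ b = Fin.last (q + 1)
    · have hrb : Fin.rev b = 0 ∨ Fin.rev b = Fin.last (q + 1) := by
        rcases hb with rfl | rfl
        · exact Or.inr (Fin.rev_zero _)
        · exact Or.inl (Fin.rev_last _)
      simp only [if_pos hb, if_pos hrb, mul_zero]
    · obtain ⟨hb0, hbl⟩ := not_or.mp hb
      have hrb0 : Fin.rev b ≠ 0 := fun h0 => hbl (by rwa [Fin.rev_eq_iff, Fin.rev_zero] at h0)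
      have hrbl : Fin.rev b ≠ Fin.last (q + 1) := fun h0 =>
        hb0 (by rwa [Fin.rev_eq_iff, Fin.rev_last] at h0)
      simp only [if_neg hb, if_neg (not_or.mpr ⟨hrb0, hrbl⟩)]
      rw [hBM b' b hb0 hbl, hBM c' (Fin.rev b) hrb0 hrbl]
      ring
  rw [h1, h2, h3, bigCwTensor_apply_eq_indicator]
  simp only [hA0, hAl, hB0, hBl]

/-- **`L_q ≥ CW_q` (restriction, indeed an isomorphism) over every field containing a square root `i` of
`−1` in which `2 ≠ 0`** — in particular over `ℂ`.  (Over `ℚ` or `ℝ` the two tensors are NOT isomorphic for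
odd `q`: the split form `Σ x_a x_{q+1−a}` and the definite form `Σ y_j²` are inequivalent; the summit is
over `ℂ`.) [cite: ChristandlVranaZuiddam2021, Thm. 22; BurgisserClausenShokrollahi1997, (14.4)] -/
theorem tensorRestrictsTo_splitCw_bigCwTensor {i : K} (hi : i * i = -1) (h2 : (2 : K) ≠ 0) (q : ℕ) :
    TensorRestrictsTo
      (fun z x y : Fin (q + 2) =>
        if (x : ℕ) + (y : ℕ) = (z : ℕ) ∧ ((x : ℕ) = 0 ∨ (y : ℕ) = 0 ∨ (z : ℕ) = q + 1) then (1 : K) else 0)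
      (bigCwTensor K q) := by
  have hh : (2 : K)⁻¹ + 2⁻¹ = 1 := by rw [← two_mul, mul_inv_cancel₀ h2]
  have hl0 : (Fin.last (q + 1) : Fin (q + 2)) ≠ 0 := by simp [Fin.ext_iff]
  exact tensorRestrictsTo_splitCw_bigCwTensor_of_matrices q _
    (fun a' a => if a = 0 then (if a' = Fin.last (q + 1) then 1 else 0)
      else if a = Fin.last (q + 1) then (if a' = 0 then 1 else 0)
      else (fun p j : Fin (q + 2) =>
        if j = p then (if (p : ℕ) ≤ (Fin.rev p : ℕ) then 1 else -(i * 2⁻¹))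
        else if j = Fin.rev p then (if (p : ℕ) < (Fin.rev p : ℕ) then i else 2⁻¹) else 0) (Fin.rev a) a')
    (fun b' b => if b = 0 then (if b' = 0 then 1 else 0)
      else if b = Fin.last (q + 1) then (if b' = Fin.last (q + 1) then 1 else 0)
      else (fun p j : Fin (q + 2) =>
        if j = p then (if (p : ℕ) ≤ (Fin.rev p : ℕ) then 1 else -(i * 2⁻¹))
        else if j = Fin.rev p then (if (p : ℕ) < (Fin.rev p : ℕ) then i else 2⁻¹) else 0) b b')
    (pairing_gram hi hh _ rfl)
    (fun a' => by (try dsimp only); rw [if_pos rfl])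
    (fun a' => by (try dsimp only); rw [if_neg hl0, if_pos rfl])
    (fun a' a ha0 hal => by (try dsimp only); rw [if_neg ha0, if_neg hal])
    (fun b' => by (try dsimp only); rw [if_pos rfl])
    (fun b' => by (try dsimp only); rw [if_neg hl0, if_pos rfl])
    (fun b' b hb0 hbl => by (try dsimp only); rw [if_neg hb0, if_neg hbl])

/-- **CURVILINEAR DOMINATION.**  Over every field with `i² = −1` and `2 ≠ 0`:
`Str(K[t]/(t^{q+2})) ⊵ CW_q` (a polynomial degeneration, BCS (15.19)/(15.29)–(15.30) followed by the
change of basis above), for EVERY `q`.  [cite: BurgisserClausenShokrollahi1997, Prop. (15.30), Ex. (15.20);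
ChristandlVranaZuiddam2021, Thm. 22] -/
theorem truncPolyMulTensor_polyDegeneratesTo_bigCwTensor {i : K} (hi : i * i = -1) (h2 : (2 : K) ≠ 0)
    (q : ℕ) : PolyDegeneratesTo (truncPolyMulTensor K (q + 2)) (bigCwTensor K q) := by
  classical
  exact (truncPolyMulTensor_polyDegeneratesTo_splitCw K q).trans_restrictsTo
    (tensorRestrictsTo_splitCw_bigCwTensor hi h2 q)

/-- The same for Kronecker powers: `P_{q+2}^{⊠N} ⊵ CW_q^{⊠N}`.
[cite: BurgisserClausenShokrollahi1997, Prop. (15.30), Lemma (15.24)] -/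
theorem truncPolyMulTensor_kroneckerPow_polyDegeneratesTo_bigCwTensor {i : K} (hi : i * i = -1)
    (h2 : (2 : K) ≠ 0) (q N : ℕ) :
    PolyDegeneratesTo (kroneckerPow (truncPolyMulTensor K (q + 2)) N) (kroneckerPow (bigCwTensor K q) N) := by
  classical
  exact (truncPolyMulTensor_polyDegeneratesTo_bigCwTensor hi h2 q).kroneckerPow N

/-- Hence `R̃(CW_q) ≤ R̃(P_{q+2})` over such fields. [cite: BurgisserClausenShokrollahi1997, Prop. (15.30), (15.26)] -/
theorem asymptoticRank_bigCwTensor_le_truncPolyMulTensor {i : K} (hi : i * i = -1) (h2 : (2 : K) ≠ 0)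
    (q : ℕ) : asymptoticRank (bigCwTensor K q) ≤ asymptoticRank (truncPolyMulTensor K (q + 2)) :=
  asymptoticRank_le_of_polyDegeneratesTo (truncPolyMulTensor_polyDegeneratesTo_bigCwTensor hi h2 q)

/-- **Curvilinear domination over `ℂ`: `Str(ℂ[t]/(t^{q+2})) ⊵ CW_q` for every `q`.**
[cite: BurgisserClausenShokrollahi1997, Prop. (15.30), Ex. (15.20); ChristandlVranaZuiddam2021, Thm. 22] -/
theorem truncPolyMulTensor_polyDegeneratesTo_bigCwTensor_complex (q : ℕ) :
    PolyDegeneratesTo (truncPolyMulTensor ℂ (q + 2)) (bigCwTensor ℂ q) :=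
  truncPolyMulTensor_polyDegeneratesTo_bigCwTensor Complex.I_mul_I two_ne_zero q

/-- `R̃(CW_q) ≤ R̃(Str(ℂ[t]/(t^{q+2})))`. [cite: BurgisserClausenShokrollahi1997, Prop. (15.30), (15.26)] -/
theorem asymptoticRank_bigCwTensor_le_truncPolyMulTensor_complex (q : ℕ) :
    asymptoticRank (bigCwTensor ℂ q) ≤ asymptoticRank (truncPolyMulTensor ℂ (q + 2)) :=
  asymptoticRank_bigCwTensor_le_truncPolyMulTensor Complex.I_mul_I two_ne_zero q

end Summit.MatrixMultiplication.MatrixMultiplication.Theorems.SaturationLadderCurvilinearDominationCw
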